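import Summits.BirchSwinnertonDyer.Rank1Residual.Additive.GordOrdinaryEverywhere
import HarnessLib

/-!
# Deuring's criterion for `j ∈ {0, 1728}` over EVERY finite field of characteristic `p ≥ 5`, both directions

HONEST FRAMING (cell `b2b-bsdres`, run/shared/lean/b2b/bsd-rank1-residual/, verbatim in every
file): the goal of the cell is to DELETE the COMBINATION-SHAPED residual classes of the
Birch–Swinnerton-Dyer formula for ALL analytic-rank `≤ 1` elliptic curves over `ℚ` — "full BSD
formula for every rank `≤ 1` curve in class `C`" assembled STRICTLY from published theorems — so
that the rank-`≤ 1` remainder becomes exactly the CONSTRUCTION-SHAPED classes, which are TYPED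
(missing-input `Prop`s), NOT attempted. This is not "finishing BSD". Sub-cell `additive-p2`,
generation 9: research route; no claim beyond the stated classes; theorems only, no named fact.

The finite-field statements behind the sub-cell's ordinary/supersingular dictionary, assembled as
EQUIVALENCES over an arbitrary finite field `F` of characteristic `p ≥ 5` (`#F = p^f`, any `f`):
for an elliptic curve `E/F` with `j(E) = 0`, **`p ∣ #F + 1 − #E(F)` (supersingular) iff
`p ≢ 1 (mod 3)`**; with `j(E) = 1728`, **iff `p ≢ 1 (mod 4)`** (Deuring 1941; Silverman *AEC*
V.4.1(a), Ex. V.4.4–4.5, there over `𝔽_p`; here over every `𝔽_{p^f}`). The two halves are gen 3's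
ordinary criterion (`SpecialJ.not_ringChar_dvd_trace_of_j_eq_zero`, whose binomial hypothesis over
`𝔽_{p^f}` is Lucas in full, `SpecialJ.natCast_choose_third_ne_zero`, gen 9) and gen 9's
supersingular criterion (`SpecialJ.ringChar_dvd_trace_of_j_eq_zero`, one Lucas step). Reusable by
any seat that reads ordinarity of a reduction with `j̃ ∈ {0, 1728}` off the residue characteristic
alone (CM curves `y² = x³ + b`, `y² = x³ + a x`; potentially good reduction of defect `3, 4, 6`).

References: M. Deuring, Abh. Math. Sem. Hamburg 14 (1941) 197–272; J. H. Silverman, *AEC*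
Thm. V.4.1(a), Ex. V.4.4, V.4.5; L. C. Washington, *Elliptic Curves* §4.6; É. Lucas (1878).
-/

noncomputable section

open scoped Classical

open WeierstrassCurve

namespace Summit.BirchSwinnertonDyer.Rank1Residual.Additive

namespace SpecialJ

section Fintype

variable {F : Type*} [Field F] [Fintype F] (E : WeierstrassCurve F) [E.IsElliptic] {p : ℕ}
  [hp : Fact p.Prime]

/-- **Deuring for `j = 0`, every finite field of characteristic `p ≥ 5`**: `E` is supersingular
(`p ∣ q + 1 − #E(F)`) iff `p ≢ 1 (mod 3)`. Silverman *AEC* V.4.1(a), Ex. V.4.4. -/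
theorem ringChar_dvd_trace_iff_of_j_eq_zero (hchar : ringChar F = p) (hp5 : 5 ≤ p) (hj : E.j = 0) :
    (p : ℤ) ∣ (Fintype.card F : ℤ) + 1 - Nat.card E.toAffine.Point ↔ ¬ 3 ∣ p - 1 := by
  refine ⟨fun hdvd h3 ↦ ?_, fun h3 ↦ ringChar_dvd_trace_of_j_eq_zero E hchar hp5 hj h3⟩
  have h := not_ringChar_dvd_trace_of_j_eq_zero E (by rw [hchar]; omega) (by rw [hchar]; omega) hj
    (dvd_card_sub_one_of_dvd hchar h3) (natCast_choose_third_ne_zero hchar (by omega) h3)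
  rw [hchar] at h
  exact h hdvd

/-- **Deuring for `j = 1728`, every finite field of characteristic `p ≥ 5`**: `E` is supersingular
iff `p ≢ 1 (mod 4)`. Silverman *AEC* V.4.1(a), Ex. V.4.5. -/
theorem ringChar_dvd_trace_iff_of_j_eq (hchar : ringChar F = p) (hp5 : 5 ≤ p) (hj : E.j = 1728) :
    (p : ℤ) ∣ (Fintype.card F : ℤ) + 1 - Nat.card E.toAffine.Point ↔ ¬ 4 ∣ p - 1 := by
  refine ⟨fun hdvd h4 ↦ ?_, fun h4 ↦ ringChar_dvd_trace_of_j_eq E hchar hp5 hj h4⟩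
  have h := not_ringChar_dvd_trace_of_j_eq E (by rw [hchar]; omega) (by rw [hchar]; omega) hj
    (dvd_card_sub_one_of_dvd hchar h4) (natCast_choose_quarter_ne_zero hchar (by omega) h4)
  rw [hchar] at h
  exact h hdvd

end Fintype

section NatCard

variable {k : Type*} [Field k] [Finite k] (E : WeierstrassCurve k) [E.IsElliptic] {p : ℕ}
  [hp : Fact p.Prime]

/-- `Nat.card` form of `ringChar_dvd_trace_iff_of_j_eq_zero` (residue fields of number fields are
`Finite`): with `j(E) = 0` in characteristic `p ≥ 5`, `p ∣ #k + 1 − #E(k) ↔ 3 ∤ p − 1` — the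
NEGATION of the tree's `HasUnitRootAt` integer test. -/
theorem dvd_trace_iff_of_j_eq_zero_of_ringChar_eq (hchar : ringChar k = p) (hp5 : 5 ≤ p)
    (hj : E.j = 0) : (p : ℤ) ∣ (Nat.card k : ℤ) + 1 - Nat.card E.toAffine.Point ↔ ¬ 3 ∣ p - 1 := by
  haveI := Fintype.ofFinite k
  rw [Nat.card_eq_fintype_card]
  exact ringChar_dvd_trace_iff_of_j_eq_zero E hchar hp5 hj

/-- `Nat.card` form of `ringChar_dvd_trace_iff_of_j_eq`: with `j(E) = 1728` in characteristic
`p ≥ 5`, `p ∣ #k + 1 − #E(k) ↔ 4 ∤ p − 1`. -/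
theorem dvd_trace_iff_of_j_eq_of_ringChar_eq (hchar : ringChar k = p) (hp5 : 5 ≤ p)
    (hj : E.j = 1728) :
    (p : ℤ) ∣ (Nat.card k : ℤ) + 1 - Nat.card E.toAffine.Point ↔ ¬ 4 ∣ p - 1 := by
  haveI := Fintype.ofFinite k
  rw [Nat.card_eq_fintype_card]
  exact ringChar_dvd_trace_iff_of_j_eq E hchar hp5 hj

end NatCard

end SpecialJ

/-! ### At a place of a number field: ordinarity of a `j̃ ∈ {0, 1728}` reduction is read off `p mod 12` -/

section Residue

open scoped NumberField

open IsDedekindDomain NumberField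

variable {F : Type*} [Field F] [NumberField F] (V : WeierstrassCurve F) [V.IsElliptic]
  (w : HeightOneSpectrum (𝓞 F)) {p : ℕ}

/-- **Good reduction with `j ≡ 0` above `p ≥ 5` is ORDINARY iff `p ≡ 1 (mod 3)`** — at any place of
any number field (`hasUnitRootAt_of_valuation_j_lt_one_of_three_dvd`, gen 9, and
`not_hasUnitRootAt_of_valuation_j_lt_one_of_not_three_dvd`, gen 9). -/
theorem hasUnitRootAt_iff_three_dvd_of_valuation_j_lt_one (hp : p.Prime) (hp5 : 5 ≤ p)
    (hpw : (p : 𝓞 F) ∈ w.asIdeal) (hgood : V.HasGoodReductionAt w) (hj : w.valuation F V.j < 1) :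
    V.HasUnitRootAt w ↔ 3 ∣ p - 1 :=
  ⟨fun h ↦ by_contra fun h3 ↦
      not_hasUnitRootAt_of_valuation_j_lt_one_of_not_three_dvd V w hp hp5 h3 hpw hgood hj h,
    fun h3 ↦ hasUnitRootAt_of_valuation_j_lt_one_of_three_dvd V w hp hp5 h3 hpw hgood hj⟩

/-- **Good reduction with `j ≡ 1728` above `p ≥ 5` is ORDINARY iff `p ≡ 1 (mod 4)`** — at any place
of any number field. -/
theorem hasUnitRootAt_iff_four_dvd_of_valuation_j_sub_lt_one (hp : p.Prime) (hp5 : 5 ≤ p)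
    (hpw : (p : 𝓞 F) ∈ w.asIdeal) (hgood : V.HasGoodReductionAt w)
    (hj : w.valuation F (V.j - 1728) < 1) : V.HasUnitRootAt w ↔ 4 ∣ p - 1 :=
  ⟨fun h ↦ by_contra fun h4 ↦
      not_hasUnitRootAt_of_valuation_j_sub_lt_one_of_not_four_dvd V w hp hp5 h4 hpw hgood hj h,
    fun h4 ↦ hasUnitRootAt_of_valuation_j_sub_lt_one_of_four_dvd V w hp hp5 h4 hpw hgood hj⟩

end Residue

end Summit.BirchSwinnertonDyer.Rank1Residual.Additive

end
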